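import Mathlib
import Summits.PneNP.PneNP.Theses.OverlapGapAlgebra
import Summits.PneNP.PneNP.Theorems.OverlapGapAlgebraSolvableImpliesStableSectionOffStrip
import Summits.PneNP.PneNP.Theorems.OverlapGapAlgebraSolvableImpliesStableSectionFirstMoment
import Summits.PneNP.PneNP.Theorems.OverlapGapAlgebraSolvableImpliesStableSectionRepairAssembly

/-!
# The crux `SolvableImpliesStableSection` (stmt-PneNP-2463) holds OFF the residual core (skeleton v4)

Line `Sketch`, lead prover-line-stmt-PneNP-2463-c2-0 — a one-theorem summary for the planner, superseding
`solvableImpliesStableSection_off_strip` (lead c1): the crux, with the single extra hypothesis that the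
parameters lie OUTSIDE the core region
`{1/(32k²) < α < 2^k log 2} ∩ {η < 1} ∩ {ν ≤ 2^{-k}} ∩ {ν ≤ 2^{-k}(e^{kα2^{-k}} - 1)}`,
is a theorem (`solvableImpliesStableSection_off_core`):
* `α ≤ 1/(32k²)` or `η ≥ 1` or `ν > 2^{-k}`: `solvableImpliesStableSection_off_strip` (leads -0 / c1);
* `α ≥ 2^k log 2`: the hypothesis is false by the first moment (`sissFM_hyp_false_of_density_ge_log_two`,
  escalated seat 0);
* `ν > 2^{-k}(e^{kα2^{-k}} - 1)`: one round of local repair (`stub_repairAssembly`, this lead, f-free) —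
  new in v4; it beats the constant section exactly when `α < 2^k log 2 / k`.
What remains of the crux is skeleton v4's parked `stub_transferCore` on the core region, which inside the
Bresler–Huang window is equivalent to the failure of the hypothesis given item 2462
(`transfer_false_without_polyTime`) and below the window asks for smooth sections at every `ν > 0`.
-/

set_option linter.dupNamespace false -- `Summit.PneNP.PneNP.…`: summit = sub-problem (D-0017)

namespace Summit.PneNP.PneNP.Cruxes.SolvableImpliesStableSection.Sketch

open Finset
open scoped Classical

/-- **The crux off the core region.** For every `k ≥ 3` and `α, η, ν > 0` with `α ≤ 1/(32k²)` or
`α ≥ 2^k log 2` or `η ≥ 1` or `ν > 2^{-k}` or `ν > 2^{-k}(e^{kα2^{-k}} - 1)`, the implication of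
`SolvableImpliesStableSection` at `(k, α, η, ν)` holds (in all but the third case without using the
solver, in the second case vacuously). -/
theorem solvableImpliesStableSection_off_core (k : ℕ) (hk : 3 ≤ k) (α η ν : ℝ) (hα : 0 < α) (hη : 0 < η)
    (hν : 0 < ν)
    (hoff : α ≤ 1 / (32 * (k : ℝ) ^ 2) ∨ (2 : ℝ) ^ k * Real.log 2 ≤ α ∨ 1 ≤ η ∨ (1 / 2 : ℝ) ^ k < ν ∨
      (1 / 2 : ℝ) ^ k * (Real.exp (k * α * (1 / 2 : ℝ) ^ k) - 1) < ν)
    (hsolv : ∃ f : List Bool → List Bool, Literature.Computability.Complexity.IsPolyTime f ∧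
      ∃ ε : ℝ, 0 < ε ∧ ∃ᶠ n : ℕ in Filter.atTop, ∀ m : ℕ, m = ⌊α * n⌋₊ → ε ≤
        ((Finset.univ.filter fun Φ : Fin m → Fin k → Fin n × Bool => ∀ i, ∃ j,
          (f (Literature.Computability.Complexity.encodingCNF.encode (List.ofFn fun a =>
            List.ofFn fun b => (((Φ a b).1 : ℕ), (Φ a b).2)))).getD (Φ i j).1 false =
              (Φ i j).2).card : ℝ) / Fintype.card (Fin m → Fin k → Fin n × Bool))
    (c : ℝ) (hc : 0 < c) :
    ∃ᶠ n : ℕ in Filter.atTop, ∀ m : ℕ, m = ⌊α * n⌋₊ →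
      ∃ g : (Fin m → Fin k → Fin n × Bool) → (Fin n → Bool),
        Real.exp (-(c * n)) * Fintype.card (Fin (k + 1) → Fin m → Fin k → Fin n × Bool) ≤
        ((Finset.univ.filter fun Ψ : Fin (k + 1) → Fin m → Fin k → Fin n × Bool =>
          let P : Fin k → ℕ → Fin m → Fin k → Fin n × Bool :=
            fun r q a b => if (a : ℕ) * k + b < q then Ψ r.succ a b else Ψ r.castSucc a b
          (∀ r : Fin k, ∀ q ≤ m * k, ((Finset.univ.filter fun i : Fin m =>
            ∀ j, g (P r q) (P r q i j).1 ≠ (P r q i j).2).card : ℝ) ≤ ν * m) ∧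
          ∀ r : Fin k, ∀ q < m * k,
            (hammingDist (g (P r q)) (g (P r (q + 1))) : ℝ) ≤ η * n).card : ℝ) := by
  have hk1 : 1 ≤ k := by omega
  rcases hoff with hlow | hhi | hη1 | hν1 | hν2
  · exact solvableImpliesStableSection_off_strip k hk α η ν hα hη hν (Or.inl hlow) hsolv c hc
  · exact absurd hsolv
      (Summit.PneNP.PneNP.Theorems.sissFM_hyp_false_of_density_ge_log_two k hk1 α hhi)
  · exact solvableImpliesStableSection_off_strip k hk α η ν hα hη hν (Or.inr (Or.inl hη1)) hsolv c hc
  · exact solvableImpliesStableSection_off_strip k hk α η ν hα hη hν (Or.inr (Or.inr hν1)) hsolv c hc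
  · exact (stub_repairAssembly k hk1 α η ν hα hη hν2 c hc).frequently

end Summit.PneNP.PneNP.Cruxes.SolvableImpliesStableSection.Sketch
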